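import Literature.NumberTheory.EllipticCurves.FineSelmerRankEqualityRoad
import Literature.NumberTheory.EllipticCurves.DivisionFieldInertiaDeterminant
import HarnessLib

/-!
# The rank-equality road at `(E, p)`: the inertia hypothesis `σ̄_m ∈ I(𝔮|p)` from a finite property of the mod-`p` image

Topic `NumberTheory/EllipticCurves` (grouping sub-namespace `CoatesSujatha2005.RankEqualityRoad`, as its parent file).  THEOREM-ONLY (no definition,
no named fact, no `sorry`); prover seat `bsd-potss-k8t-c4` g26 (cell `bsd-potss`, `--supports stmt-BirchSwinnertonDyer-19982`; closes nothing;
neither BSD nor Conjecture A is booked for any curve).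

The image-agnostic rank-equality road (k8t-c4 g25, `conjA_of_rankEq`: `E/ℚ`, `p` odd, `p ∤ #Gal(ℚ(E[p])/ℚ)`, basis data `σ_s ↦ S` (first row `(1,0)`),
`σ_m ↦ −1`, `σ_x ↦ X` (`X₀₁ ≠ 0`), and the layer-0 rank equality `#Cl(L^⟨σ̄_s⟩)[p] = #Cl(L^⟨σ̄_m, σ̄_s⟩)[p]`) displays ONE more per-row input:
`hcI : σ̄_m ∈ I(𝔮)` for every prime `𝔮 ∋ p` of `L = ℚ(E[p])`.  THIS FILE derives `hcI` from a FINITE, DECIDABLE property of the displayed image: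

* `mem_inertia_of_forall_det_eq_exists_pow_eq` — if `Γ_ℚ` acts on `E[p]` through a set `T` of matrices (`he`) and EVERY `M ∈ T` of some fixed
  determinant `u ∈ 𝔽_pˣ` has a power equal to the matrix `N` of `σ_m`, then `σ̄_m ∈ I(𝔮)` for every maximal `𝔮 ∋ p` of `𝓞 ℚ(E[p])`.  Proof:
  `det ρ̄_{E,p}(I(𝔮|p)) = 𝔽_pˣ` (`DivisionFieldInertia.exists_mem_inertia_divisionField_det_rep_eq`: Weil pairing + `ℚ(ζ_p)/ℚ` totally ramified at
  `p`) gives `g ∈ I(𝔮)` with `det ρ̄(g) = u`; `ρ̄(g) ∈ T`, so `ρ̄(g)^k = N = ρ̄(σ̄_m)`, and `ρ̄` is faithful on `Gal(ℚ(E[p])/ℚ)`;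
* `conjA_of_rankEq_of_forall_det_eq_exists_pow_eq` — g25's `conjA_of_rankEq` with `hcI` replaced by that property (`T`, `u` displayed; e.g.
  `T = C_ns⁺(ε) ≤ GL₂(𝔽₅)`, `u = 2`, power `12` — the sibling file `FineSelmerRankEqualityNonsplitCartanFiveInertia`; or the index-`2` subgroup
  `G₁₆ ≅ M₁₆` of `C_s⁺(5)`).  The property FAILS for the full `C_s⁺(5)` and for Zywina's `G₉` (`5S4`) (e.g. `diag(1,2)`), where `hcI` stays displayed.

## References

* J.-P. Serre, *Propriétés galoisiennes des points d'ordre fini des courbes elliptiques*, Invent. Math. 15 (1972), §2.2, §5.2 (iii). [Serre1972]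
* J. Coates, R. Sujatha, *Fine Selmer groups of elliptic curves over p-adic Lie extensions*, Math. Ann. 331 (2005), §3 Thm. 3.4. [CoatesSujatha2005]
* K. Iwasawa, *A note on class numbers of algebraic number fields*, Abh. Math. Sem. Hamburg 20 (1956). [Iwasawa1956]
-/

set_option autoImplicit false

noncomputable section

open scoped Classical NumberField Matrix
open WeierstrassCurve Field IntermediateField
  Literature.NumberTheory.GaloisRepresentations Literature.NumberTheory.IwasawaTheory
  Literature.NumberTheory.NumberFields Literature.NumberTheory.EllipticCurves.DivisionFieldInertia

namespace Literature.NumberTheory.EllipticCurves.CoatesSujatha2005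

namespace RankEqualityRoad

/-! ### §0 Helpers -/

/-- Two matrices acting alike on all `e P` coincide (`e` onto). [folklore] -/
private theorem matrix_eq_of_forall_mulVec₄ {A : Type*} [AddCommGroup A] {n : ℕ} (e : A ≃+ (Fin 2 → ZMod n))
    {M N : Matrix (Fin 2) (Fin 2) (ZMod n)} (h : ∀ P : A, M *ᵥ e P = N *ᵥ e P) : M = N := by
  have h' : ∀ v, M *ᵥ v = N *ᵥ v := fun v => by simpa using h (e.symm v)
  ext i j
  have := congrFun (h' (Pi.single j 1)) i
  simpa [Matrix.mulVec_single] using this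

/-- Restriction `Γ_F → Gal(E/F)` is onto. [folklore] -/
private theorem absRestrictNormalHom_surjective₄ {F : Type} [Field F] (E : IntermediateField F (AlgebraicClosure F))
    [Normal F E] : Function.Surjective (absRestrictNormalHom E) := fun g => by
  obtain ⟨σ, hσ⟩ := AlgEquiv.restrictNormalHom_surjective (AlgebraicClosure F) g
  exact ⟨(Field.absoluteGaloisGroup.toAlgEquiv F).symm σ, hσ⟩

/-! ### §1 The inertia input from a finite property of the image -/

/-- **`σ̄_m ∈ I(𝔮|p)` from the image.**  `E/ℚ` elliptic, `p` prime, `Γ_ℚ` acting on `E[p]` in the additive frame `e` through matrices of the set `T`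
(`he`), `σ_m ∈ Γ_ℚ` acting by the matrix `N`.  If every `M ∈ T` with `det M = u` (a fixed unit `u ∈ 𝔽_pˣ`) has some power equal to `N`, then the
restriction of `σ_m` to `L = ℚ(E[p])` lies in the inertia group of EVERY maximal ideal `𝔮 ∋ p` of `𝓞 L`.  (`I(𝔮)` contains an element of determinant
`u` — `DivisionFieldInertia.exists_mem_inertia_divisionField_det_rep_eq`, Weil pairing + total ramification of `p` in `ℚ(ζ_p)` — and `Gal(L/ℚ)` acts
faithfully on `E[p]`.) [cite: Serre1972, §5.2 (iii)] -/
theorem mem_inertia_of_forall_det_eq_exists_pow_eq (W : WeierstrassCurve ℚ) [W.IsElliptic] (p : ℕ) [Fact p.Prime]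
    (e : W.geomTorsion (p : ℕ) ≃+ (Fin 2 → ZMod p)) {T : Set (Matrix (Fin 2) (Fin 2) (ZMod p))}
    (he : ∀ σ : absoluteGaloisGroup ℚ, ∃ M ∈ T, ∀ P : W.geomTorsion (p : ℕ), e (σ • P) = M *ᵥ e P)
    (u : (ZMod p)ˣ) {N : Matrix (Fin 2) (Fin 2) (ZMod p)} (hT : ∀ M ∈ T, M.det = (u : ZMod p) → ∃ k : ℕ, M ^ k = N)
    (σm : absoluteGaloisGroup ℚ) (hσm : ∀ P : W.geomTorsion (p : ℕ), e (σm • P) = N *ᵥ e P)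
    (𝔮 : Ideal (𝓞 ↥(W.divisionField p))) [𝔮.IsMaximal] (h𝔮 : ((p : ℕ) : 𝓞 ↥(W.divisionField p)) ∈ 𝔮) :
    absRestrictNormalHom (W.divisionField p) σm ∈ 𝔮.inertia (↥(W.divisionField p) ≃ₐ[ℚ] ↥(W.divisionField p)) := by
  haveI : NeZero p := ⟨(Fact.out : p.Prime).ne_zero⟩
  -- the faithful matrix representation of `Gal(ℚ(E[p])/ℚ)` in the basis `e`
  obtain ⟨ρm, hρm, hρme⟩ := exists_matrixRep_divisionField W p e
  have hmat : ∀ (σ : absoluteGaloisGroup ℚ) (M : Matrix (Fin 2) (Fin 2) (ZMod p)),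
      (∀ P, e (σ • P) = M *ᵥ e P) → ρm (absRestrictNormalHom _ σ) = M :=
    fun σ M hM => matrix_eq_of_forall_mulVec₄ e fun P => by rw [← hρme, hM]
  -- an inertia element of determinant `u`
  obtain ⟨g, hgI, hgdet⟩ := exists_mem_inertia_divisionField_det_rep_eq W p e ρm hρme 𝔮 h𝔮 u
  obtain ⟨σ, rfl⟩ := absRestrictNormalHom_surjective₄ (W.divisionField p) g
  obtain ⟨M, hM, hMe⟩ := he σ
  have hρσ : ρm (absRestrictNormalHom _ σ) = M := hmat σ M hMe
  obtain ⟨k, hk⟩ := hT M hM (by rw [← hρσ]; exact hgdet)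
  have heq : absRestrictNormalHom (W.divisionField p) σm = absRestrictNormalHom (W.divisionField p) σ ^ k :=
    hρm (by rw [hmat σm N hσm, map_pow, hρσ, hk])
  rw [heq]
  exact Subgroup.pow_mem _ hgI k

/-- The same with `σ_m` acting as `−1` (`e (σ_m • P) = −e P`), the shape of the rank-equality road's `hσm`: if every `M ∈ T` of determinant `u` has
a power equal to `−1`, then `σ̄_m ∈ I(𝔮)` for every maximal `𝔮 ∋ p` of `𝓞 ℚ(E[p])`. [cite: Serre1972, §5.2 (iii)] -/
theorem mem_inertia_of_forall_det_eq_exists_pow_eq_neg_one (W : WeierstrassCurve ℚ) [W.IsElliptic] (p : ℕ) [Fact p.Prime]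
    (e : W.geomTorsion (p : ℕ) ≃+ (Fin 2 → ZMod p)) {T : Set (Matrix (Fin 2) (Fin 2) (ZMod p))}
    (he : ∀ σ : absoluteGaloisGroup ℚ, ∃ M ∈ T, ∀ P : W.geomTorsion (p : ℕ), e (σ • P) = M *ᵥ e P)
    (u : (ZMod p)ˣ) (hT : ∀ M ∈ T, M.det = (u : ZMod p) → ∃ k : ℕ, M ^ k = -1)
    (σm : absoluteGaloisGroup ℚ) (hσm : ∀ P : W.geomTorsion (p : ℕ), e (σm • P) = -e P)
    (𝔮 : Ideal (𝓞 ↥(W.divisionField p))) [𝔮.IsMaximal] (h𝔮 : ((p : ℕ) : 𝓞 ↥(W.divisionField p)) ∈ 𝔮) :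
    absRestrictNormalHom (W.divisionField p) σm ∈ 𝔮.inertia (↥(W.divisionField p) ≃ₐ[ℚ] ↥(W.divisionField p)) :=
  mem_inertia_of_forall_det_eq_exists_pow_eq W p e he u hT σm
    (fun P => by rw [hσm P, Matrix.neg_mulVec, Matrix.one_mulVec]) 𝔮 h𝔮

/-! ### §2 Statement (A) at `(E, p)` from the rank equality and the finite image property -/

/-- **(A) at `(E, p)` from the rank equality, inertia input read off the image.**  `E/ℚ`, `p` odd, `p ∤ #Gal(ℚ(E[p])/ℚ)`; `Γ_ℚ` acts on `E[p]`
in the frame `e` through the set `T` of matrices (`he`); basis data `σ_s ↦ S` (first row `(1,0)`), `σ_m ↦ −1`, `σ_x ↦ X` (`X₀₁ ≠ 0`); every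
`M ∈ T` with `det M = u` has a power equal to `−1` (`hT`, decidable per image); and `#Cl(L^⟨σ̄_s⟩)[p] = #Cl(L^⟨σ̄_m, σ̄_s⟩)[p]` at layer 0 (`hrank`).
Then the dual fine Selmer group of `E` over `ℚ_cyc` is finitely generated over `ℤ_p` for every cyclotomic `ℤ_p`-extension: g25's `conjA_of_rankEq`
with `hcI` supplied by §1. [cite: CoatesSujatha2005, §3 Thm. 3.4 and Lemma 3.8] [cite: Iwasawa1956, §§3–5] [cite: Serre1972, §2.2 and §5.2 (iii)] -/
theorem conjA_of_rankEq_of_forall_det_eq_exists_pow_eq (W : WeierstrassCurve ℚ) [W.IsElliptic] {p : ℕ} [Fact p.Prime] (hp2 : p ≠ 2)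
    (hG : ¬ p ∣ Nat.card (↥(W.divisionField p) ≃ₐ[ℚ] ↥(W.divisionField p)))
    (e : W.geomTorsion p ≃+ (Fin 2 → ZMod p)) {T : Set (Matrix (Fin 2) (Fin 2) (ZMod p))}
    (he : ∀ σ : absoluteGaloisGroup ℚ, ∃ M ∈ T, ∀ P : W.geomTorsion p, e (σ • P) = M *ᵥ e P)
    (u : (ZMod p)ˣ) (hT : ∀ M ∈ T, M.det = (u : ZMod p) → ∃ k : ℕ, M ^ k = -1)
    (σs σm σx : absoluteGaloisGroup ℚ)
    {S : Matrix (Fin 2) (Fin 2) (ZMod p)} (hS0 : S 0 0 = 1) (hS1 : S 0 1 = 0)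
    (hσs : ∀ P : W.geomTorsion p, e (σs • P) = S *ᵥ e P)
    (hσm : ∀ P : W.geomTorsion p, e (σm • P) = -e P)
    {X : Matrix (Fin 2) (Fin 2) (ZMod p)} (hX : X 0 1 ≠ 0) (hσx : ∀ P : W.geomTorsion p, e (σx • P) = X *ᵥ e P)
    (hrank : Nat.card {d : ClassGroup (𝓞 ↥(fixedField (Subgroup.zpowers (absRestrictNormalHom (W.divisionField p) σs)))) // d ^ p = 1} =
      Nat.card {d : ClassGroup (𝓞 ↥(fixedField (Subgroup.zpowers (absRestrictNormalHom (W.divisionField p) σm) ⊔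
        Subgroup.zpowers (absRestrictNormalHom (W.divisionField p) σs)))) // d ^ p = 1})
    (κ : ZpExtension ℚ p) (hκ : κ.IsCyclotomic) :
    ∃ (γ : absoluteGaloisGroup ℚ) (D : W.FineSelmerDualData κ γ),
      Module.Finite ℤ_[p] (RestrictScalars ℤ_[p] (IwasawaAlgebra p) D.X) :=
  conjA_of_rankEq W hp2 hG e σs σm σx hS0 hS1 hσs hσm hX hσx hrank
    (fun 𝔮 _ h𝔮 => mem_inertia_of_forall_det_eq_exists_pow_eq_neg_one W p e he u hT σm hσm 𝔮 h𝔮) κ hκ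

end RankEqualityRoad

end Literature.NumberTheory.EllipticCurves.CoatesSujatha2005

end
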